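import Summits.MatrixMultiplication.OmegaCensus.STPPSmallPatternOnsetLaws
import Summits.MatrixMultiplication.OmegaCensus.STPPSmallPatternT2K4OrderLaw
import Summits.MatrixMultiplication.OmegaCensus.STPPSmallPatternT1K4OrderLaw
import Summits.MatrixMultiplication.OmegaCensus.STPPSmallPatternT1K6OrderLawIff
import Mathlib.GroupTheory.Index

/-!
# ω-census, small STPP patterns `(1,2,2)^k` / `(2,1,1)^k`: Conjecture C10 — the T2 ONSET STRUCTURE (typed statement; kernel rows `k ≤ 6`)

Cell `pub-omega` (unit `pub-omega-stpp-1-g35`, DESK-ASK `c10-typed`, RULING L41-2′), topic `Summits/MatrixMultiplication/OmegaCensus`.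
HONEST FRAMING (verbatim): lottery ticket; floor = certified bounds/negative ranges.  This file TYPES conjecture C10 of the cell's
STRUCTURE.md §2 (registered 2026-08-28T15:05:11Z by lead g37; status at typing `22-surviving`, 2026-08-29T08:3xZ, lead g41) as Lean
`Prop`s — one `def` per live clause and `C10 := C10a ∧ C10b ∧ C10b' ∧ C10c ∧ C10c''` — so that the conjecture is refutable BY NAME
(a future `theorem not_C10c : ¬ C10c` is an X-entry with a declaration).  The clauses are NOT proved and NOT asserted.  What IS proved
is bookkeeping: the rows `k ≤ 6` that the tree's closed forms already decide, as literal instances of the per-`k` predicates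
(`C10.liftTightAt_two … C10.cyclicLastAt_six`).  Nothing here is a census word or bears on `ω`: `(1,2,2)^k` families are far
below the beating threshold; the value is a LAW for the census column B5.

OBJECTS (CKSU 2005 Def. 5.1, tree `IsSTPP`).  `C10.Hosts122 G k` = "`G` hosts the size pattern `(1,2,2)^k`" = `k` simultaneous-TPP
triples `(Aᵢ, Bᵢ, Cᵢ)` with `#Aᵢ = 1, #Bᵢ = #Cᵢ = 2` (the census column `T2(G) = max k`); `C10.Hosts211 G k` = the pattern `(2,1,1)^k`
(column `T1`).  House style of `stpp122pow4_iff`: «every finite abelian group» = `∀ (G : Type) [AddCommGroup G] [Finite G]`, orders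
as `Nat.card G`.  The census onsets `onset_T1(k) = min {|H| : (2,1,1)^k ⊆ H}`, `onset_T2(k)`, `c_k = min {m : (1,2,2)^k ⊆ ℤ/m}`,
`r_k = min {m : (2,1,1)^k ⊆ ℤ/m}` are NOT introduced as functions (no `sInf` / `Nat.find`): every clause is written
ORDER-QUANTIFIED, and each docstring states the equivalence with the STRUCTURE wording.  `ZMod 0 = ℤ` hosts every pattern, so
cyclic statements carry `1 ≤ m`.

C10 — THE CLAUSES (STRUCTURE.md §2, verbatim wording in each docstring):
(a) LIFT-TIGHT `C10a`: `onset_T2(k) = 2 · onset_T1(k)` for every `k ≥ 2`, and the hosts AT the onset order are exactly the groups with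
    a `T1 = k` quotient of index `2`.  (`≤` is the tree's fat quotient lift `exists_isSTPP_122_of_211_of_surjective`, KERNEL for every
    `k`; the typed content is `≥` = `C10.LiftTightAt k`, plus `C10.OnsetHostsAt k`.)
(b) T2 CYCLIC RAYS `C10b`: for every `k` the cyclic host set `{m : (1,2,2)^k ⊆ ℤ/m}` is a full ray (no gaps) = `C10.CyclicRayT2At k`.
(b′) T1 CYCLIC RAYS `C10b'`: the same for `(2,1,1)^k` = `C10.CyclicRayT1At k`.
(c) ORDER-NOT-TYPE ABOVE THE ONSET `C10c`: for every `k` and every `n > onset_T2(k)`, EVERY abelian group of order `n` hosts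
    `(1,2,2)^k` = `C10.OrderNotTypeAt k`.
(c″) CYCLIC-LAST `C10c''`: for every `k ≥ 2` and every `n ≥ r_k`, EVERY abelian group of order `n` hosts `(2,1,1)^k` = `C10.CyclicLastAt k`.
Clause (c′) («order-not-type above onset_T1») was REFUTED AS WORDED (X-33: `not_exists_isSTPP_211pow4_of_card_eq_17`, `(k, n) = (4, 17)`)
and is superseded by (c″); it is not typed.

EVIDENCE LEDGER (cell ids; KERNEL = a tree theorem; ×n = n exact engines outside the kernel; P-nnn = pre-registered tests, STRUCTURE §3):
* rows `k = 2, 3`: all five clauses KERNEL — closed forms `stpp122pow2_iff_card` (`(1,2,2)² ⊆ G ⟺ |G| ≥ 12`), `stpp211pow2_iff_card`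
  (`⟺ |G| ≥ 6`), `stpp122pow3_iff_card` (`⟺ 24`), `stpp211pow3_iff_card` (`⟺ 12`); this file: `C10.liftTightAt_two/three`,
  `cyclicRayT2At_two/three`, `cyclicRayT1At_two/three`, `orderNotTypeAt_two/three`, `cyclicLastAt_two/three`.
* row `k = 4`: onset_T2(4) = 32 = 2·16 EXACT KERNEL (`stpp122pow4_onset_eq_32`, `stpp122pow4_iff`:
  `(1,2,2)⁴ ⊆ G ⟺ |G| ≥ 33 ∨ (|G| = 32 ∧ ¬cyclic ∧ ¬elementary)`; T1 twin `stpp211pow4_iff` with `18 / 16`); this file: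
  `liftTightAt_four`, `cyclicRayT2At_four`, `cyclicRayT1At_four`, `orderNotTypeAt_four` (= P-087.2 HIT, orders 33–47 all host),
  `cyclicLastAt_four`.
* rows `k = 5, 6`: T1 closed forms `stpp211pow5_iff_card` (`⟺ 24`), `stpp211pow6_iff_card` (`⟺ 30`) ⇒ `cyclicRayT1At_five/six`,
  `cyclicLastAt_five/six` (this file); T2 host laws `exists_isSTPP_122pow5_of_card_ge_48`, `exists_isSTPP_122pow6_of_card_ge_64`
  (KERNEL upper sides); onset_T2(5) ∈ [38, 48] (P-084.1 / GO #106 pending), onset_T2(6): orders 48–59 = P-087.1 / GO #109 pending,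
  cyclic cells ℤ/61, ℤ/63 at k = 6 = P-087.4 pending.
* rows `k = 7 … 13`: host laws KERNEL (`exists_isSTPP_122pow7_of_card_ge_76_of_ne`, `exists_isSTPP_211pow7_of_card_ge_38`,
  `exists_isSTPP_211pow8_of_card_ge_45` (r₈ = 45: P-092.3 HIT, P-069.4 HIT; onset_T1(8) = 45: P-108.1′ MISS → X-39),
  `exists_isSTPP_122pow8_of_even_card_ge_90`, rays `STPPSmallPatternCyclicRaysT1K9 … K12` / `…T2K7/K8`,
  `exists_isSTPP_122pow12_of_card_ge_236` (P-105 HIT), `exists_isSTPP_122pow13_of_card_ge_276` (P-109.1 law HIT #33; threshold sub-line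
  MISS as pre-stated)); scored tests of (c): P-087.2 HIT, P-093.1 pending ((ℤ/3)⁴ at k = 7 undecided, X-38), P-095.1 HIT, P-096.1 HIT,
  P-109.1 HIT; of (c″): P-092.1 HIT (6/6), P-095.2 HIT, P-096.2 HIT, P-092.3 HIT; of (b′): P-090.1 pending (ℤ/71, k = 10); (a) at k = 8
  re-targeted to onset_T2(8) = 90 = P-112.
* counterexamples: none to (a), (b), (b′), (c), (c″).  Status at typing: 22-surviving (STRUCTURE §2 C10 annexes, lead g41 2026-08-29).

References: H. Cohn, R. Kleinberg, B. Szegedy, C. Umans, *Group-theoretic algorithms for matrix multiplication*, FOCS 2005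
(arXiv:math/0511460), Def. 5.1.  Census records: HOME `STRUCTURE.md` §2 C10, §3 (P-084 … P-112), OMEGA-TABLE Pb230 / B5.
-/

namespace Summit.MatrixMultiplication.OmegaCensus

open Finset Literature.Computability.AlgebraicComplexity

namespace C10

/-! ## The two host predicates (columns T2 and T1 of the census) -/

/-- `G` HOSTS THE SIZE PATTERN `(1,2,2)^k`: there are `k` triples `(Aᵢ, Bᵢ, Cᵢ)` of subsets of `G` with `#Aᵢ = 1`, `#Bᵢ = #Cᵢ = 2`
satisfying the simultaneous triple product property (CKSU Def. 5.1, tree `IsSTPP`).  Census column `T2(G) = max k`.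
[cite: CohnKleinbergSzegedyUmans2005, Def. 5.1] -/
def Hosts122 (G : Type*) [AddCommGroup G] (k : ℕ) : Prop :=
  ∃ A B C : Fin k → Finset G, IsSTPP A B C ∧ ∀ i, (A i).card = 1 ∧ (B i).card = 2 ∧ (C i).card = 2

/-- `G` HOSTS THE SIZE PATTERN `(2,1,1)^k` (CKSU Def. 5.1, tree `IsSTPP`).  Census column `T1(G) = max k`.
[cite: CohnKleinbergSzegedyUmans2005, Def. 5.1] -/
def Hosts211 (G : Type*) [AddCommGroup G] (k : ℕ) : Prop :=
  ∃ A B C : Fin k → Finset G, IsSTPP A B C ∧ ∀ i, (A i).card = 2 ∧ (B i).card = 1 ∧ (C i).card = 1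

/-! ## Clause (a): LIFT-TIGHT -/

/-- **C10 (a), first sentence, the TIGHT half at `k`** — STRUCTURE wording: «onset_T2(k) = 2 · onset_T1(k)» ('≤' is the fat quotient
lift, KERNEL: `exists_isSTPP_122_of_211_of_surjective`; '=' is the content).  ORDER-QUANTIFIED form of `onset_T2(k) ≥ 2 · onset_T1(k)`:
for every `n`, if no finite abelian group of order `≤ n` hosts `(2,1,1)^k`, then no finite abelian group of order `≤ 2n + 1` hosts
`(1,2,2)^k` (take `n = onset_T1(k) − 1`).  FALSIFIER: any abelian `H` with `|H| < 2 · onset_T1(k)` hosting `(1,2,2)^k`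
(k = 5: an order 38–47 host = P-084.1 MISS; k = 6: an order 48–59 host = P-087.1 MISS).  KERNEL for `k = 2, 3, 4` (`12 = 2·6`,
`24 = 2·12`, `32 = 2·16`: `liftTightAt_two/three/four`).  OPEN — a `def`, never
asserted without proof (CONVENTIONS §4). -/
def LiftTightAt (k : ℕ) : Prop :=
  ∀ n : ℕ, (∀ (H : Type) [AddCommGroup H] [Finite H], Nat.card H ≤ n → ¬ Hosts211 H k) →
    ∀ (G : Type) [AddCommGroup G] [Finite G], Nat.card G ≤ 2 * n + 1 → ¬ Hosts122 G k

/-- **C10 (a), second sentence at `k`** — STRUCTURE wording: «the hosts AT the onset order are exactly the groups with a T1 = k quotient of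
index 2».  ORDER-QUANTIFIED: every finite abelian group `G` hosting `(1,2,2)^k` such that no finite abelian group of smaller order hosts
it has a subgroup `N` of index `2` whose quotient hosts `(2,1,1)^k` (the converse — such a `G` hosts — is the fat quotient lift, KERNEL;
«T1 = k» is typed as «hosts `(2,1,1)^k`», i.e. `T1 ≥ k`, which is the same unless `onset_T1(k + 1) = onset_T1(k)`).  Evidence: k = 4,
order 32: the hosts are exactly the five types with a non-cyclic non-elementary quotient of order 16 (`stpp122pow4_order32_iff`,
`stpp211pow4_order16_iff`, `stpp_order16_order32_same_shape`, KERNEL); k = 2, 3: every type of order 12 / 24 hosts (KERNEL).  OPEN — a `def`, never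
asserted without proof (CONVENTIONS §4). -/
def OnsetHostsAt (k : ℕ) : Prop :=
  ∀ (G : Type) [AddCommGroup G] [Finite G], Hosts122 G k →
    (∀ (G' : Type) [AddCommGroup G'] [Finite G'], Nat.card G' < Nat.card G → ¬ Hosts122 G' k) →
    ∃ N : AddSubgroup G, N.index = 2 ∧ Hosts211 (G ⧸ N) k

end C10

/-- **C10 (a) LIFT-TIGHT** (STRUCTURE.md §2 C10, verbatim): «onset_T2(k) = 2 · onset_T1(k) for every k ≥ 2, and the hosts AT the onset
order are exactly the groups with a T1 = k quotient of index 2. ('≤' is the fat quotient lift p624864 — KERNEL for k = 2…8: ≤ 12, 24,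
32, 48, 60, 76, 102; '=' is the content.)»  Typed as `∀ k ≥ 2, C10.LiftTightAt k ∧ C10.OnsetHostsAt k`.  Evidence ledger: EXACT KERNEL
at k = 2, 3, 4 (`stpp122pow2_onset_eq_12`, `stpp122pow3_onset_eq_24`, `stpp122pow4_onset_eq_32` with `stpp211pow2/3_iff_card`,
`stpp211pow4_iff`); k = 5: `≤ 48` KERNEL, orders 38–47 = P-084.1 (GO #106) pending; k = 6: `≤ 60` KERNEL, orders 48–59 = P-087.1
(GO #109) pending; k = 7: `≤ 76`; k = 8: re-targeted «onset_T2(8) = 90 = 2·45» = P-112 (onset_T1(8) = 45, X-39).  OPEN — a `def`, never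
asserted without proof (CONVENTIONS §4). -/
def C10a : Prop := ∀ k : ℕ, 2 ≤ k → C10.LiftTightAt k ∧ C10.OnsetHostsAt k

namespace C10

/-! ## Clauses (b), (b′): CYCLIC RAYS -/

/-- **C10 (b) at `k`** — STRUCTURE wording: «the cyclic host set { m : (1,2,2)^k ⊆ ℤ/m } is the full ray [c_k, ∞) (no gaps)».
ORDER-QUANTIFIED: `ℤ/m` hosts ⇒ `ℤ/(m+1)` hosts, for every `m ≥ 1`.  FALSIFIER: any `m` with `ℤ/m` a host and `ℤ/(m+1)` not
(P-087.4 probes k = 6 at m = 61, 63).  KERNEL for k = 2, 3, 4 (rays `[12, ∞)`, `[24, ∞)`, `[33, ∞)`: `exists_isSTPP_122pow2/3_zmod_iff`,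
`stpp122pow4_iff`); k = 6: all `m ≥ 60` except possibly 61, 63; k = 7: all `m ≥ 76` except possibly 77, 79 (`STPPSmallPatternCyclicRaysT2K6/K7`,
`…CyclicFatLifts`).  OPEN — a `def`, never
asserted without proof (CONVENTIONS §4). -/
def CyclicRayT2At (k : ℕ) : Prop :=
  ∀ m : ℕ, 1 ≤ m → Hosts122 (ZMod m) k → Hosts122 (ZMod (m + 1)) k

/-- **C10 (b′) at `k`** — STRUCTURE wording: «the cyclic host set { m : (2,1,1)^k ⊆ ℤ/m } is a full ray [r_k, ∞) (no gaps)».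
ORDER-QUANTIFIED: `ℤ/m` hosts ⇒ `ℤ/(m+1)` hosts, for every `m ≥ 1`.  FALSIFIER: any `m` with `ℤ/m` a host and `ℤ/(m+1)` not.  KERNEL
for k = 2 … 6 (exact rays `m ≥ 6 / 12 / 18 / 24 / 30`: `exists_isSTPP_211pow2…5_zmod_iff`, `stpp211pow6_iff_card`) and k = 7, 8
from the onsets (`m ≥ 38`, `m ≥ 45`); k = 9: ray ⊇ [61, ∞); k = 10: hosts 70 and every `m ≥ 72`, `71` undecided = P-090.1; k = 11, 12,
13: rays ⊇ [82, ∞) / [96, ∞) ∖ {97} / [116, ∞) (tree `STPPSmallPatternCyclicRaysT1K9 … K12`, `…CyclicThreeAPFreeRungs`).  OPEN — a `def`, never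
asserted without proof (CONVENTIONS §4). -/
def CyclicRayT1At (k : ℕ) : Prop :=
  ∀ m : ℕ, 1 ≤ m → Hosts211 (ZMod m) k → Hosts211 (ZMod (m + 1)) k

end C10

/-- **C10 (b) T2 CYCLIC RAYS** (STRUCTURE.md §2 C10, verbatim): «for every k the cyclic host set { m : (1,2,2)^k ⊆ ℤ/m } is the full ray
[c_k, ∞) (no gaps), with c_k ≤ I_k (the integer family transported by `stppCheck_map_intCast_zmod` gives ⊇ [I_k, ∞) — KERNEL) and
c_k < I_k allowed (wrap-around hosts: c_4 = 33 < 35 = I_4).»  Typed as `∀ k, C10.CyclicRayT2At k` (the bound `c_k ≤ I_k` is a theorem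
for each integer witness and is not part of the typed content).  Evidence: rows k = 2, 3, 4 KERNEL (this file: `cyclicRayT2At_two/three/four`);
k = 5: c₅ ∈ [38, 48] (GO #106); k = 6: P-087.4 (ℤ/61, ℤ/63) pending; k = 7: ℤ/77, ℤ/79 open.  OPEN — a `def`, never
asserted without proof (CONVENTIONS §4). -/
def C10b : Prop := ∀ k : ℕ, C10.CyclicRayT2At k

/-- **C10 (b′) T1 CYCLIC RAYS** (STRUCTURE.md §2 C10, verbatim; registered as a scored clause 2026-08-28T16:57:53Z by lead g37 with prereg
P-090): «for every k the cyclic host set { m : (2,1,1)^k ⊆ ℤ/m } is a full ray [r_k, ∞) (no gaps)».  Typed as `∀ k, C10.CyclicRayT1At k`.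
Evidence (KERNEL, ENG2 g32–g35): exact rays k = 2 … 6 (this file: `cyclicRayT1At_two … six`); k = 7: `m ≥ 38`; k = 8: `m ≥ 45` exactly
above the engine-complete NONE range (r₈ = 45, P-092.3 HIT); k = 9 … 13 rays from 61 / 72 (70 hosts, 71 = P-090.1 pending) / 82 / 96 (97 open) / 116.
OPEN — a `def`, never
asserted without proof (CONVENTIONS §4). -/
def C10b' : Prop := ∀ k : ℕ, C10.CyclicRayT1At k

namespace C10

/-! ## Clauses (c), (c″): ORDER-NOT-TYPE and CYCLIC-LAST -/

/-- **C10 (c) at `k`** — STRUCTURE wording: «for every n > onset_T2(k), EVERY abelian group of order n hosts (1,2,2)^k (AT the onset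
order the type may matter)».  ORDER-QUANTIFIED (equivalent): if SOME finite abelian group `H` hosts `(1,2,2)^k`, then EVERY finite
abelian group of order `> |H|` hosts it.  FALSIFIER: a complete NONE for `(1,2,2)^k` at any abelian type of order `n > onset_T2(k)`.
Named failure mode to watch (not a clause): small exponent (elementary abelian types) just above an onset — `(ℤ/3)⁴` at k = 7 is
P-093.1, undecided (X-38).  KERNEL for k = 2, 3, 4 (`orderNotTypeAt_two/three/four`; k = 4 = P-087.2 HIT: orders 33–47 all host,
`stpp122pow4_iff`); k = 5, 6, 7: host laws from 48 / 64 (60 except 61, 63) / 76 (except 77, 79, 81) KERNEL; k = 9, 10, 12, 13: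
P-095.1, P-096.1, P-105, P-109.1 HIT.  OPEN — a `def`, never
asserted without proof (CONVENTIONS §4). -/
def OrderNotTypeAt (k : ℕ) : Prop :=
  ∀ (H : Type) [AddCommGroup H] [Finite H], Hosts122 H k →
    ∀ (G : Type) [AddCommGroup G] [Finite G], Nat.card H < Nat.card G → Hosts122 G k

/-- **C10 (c″) at `k`** — STRUCTURE wording: «for every n ≥ r_k := min { m : (2,1,1)^k ⊆ ℤ/m }, EVERY abelian group of order n hosts
(2,1,1)^k (the cyclic group is the LAST abelian type of each order to host; equivalently T1(G) ≥ T1(ℤ/|G|) plus the cyclic ray)».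
ORDER-QUANTIFIED (equivalent): if `ℤ/m` (`m ≥ 1`) hosts `(2,1,1)^k`, then EVERY finite abelian group of order `≥ m` hosts it.
FALSIFIER: a complete NONE for `(2,1,1)^k` at any abelian type of order `n ≥ r_k`.  KERNEL-TRUE at k = 2, 3, 4, 5, 6
(`cyclicLastAt_two … six`: `stpp211pow2/3/5/6_iff_card`, `stpp211pow4_iff` with `exists_isSTPP_211pow4_zmod_iff`; r = 6, 12, 18, 24, 30);
k = 7: hosts above 38 KERNEL (`exists_isSTPP_211pow7_of_card_ge_38`; complete iff r₇ = 38, engine ×2); k = 8: r₈ = 45 and every order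
`≥ 45` hosts (`exists_isSTPP_211pow8_of_card_ge_45`, KERNEL; P-092.1 HIT 6/6, P-092.3 HIT); k = 9, 10: P-095.2, P-096.2 HIT.  OPEN — a `def`, never
asserted without proof (CONVENTIONS §4). -/
def CyclicLastAt (k : ℕ) : Prop :=
  ∀ m : ℕ, 1 ≤ m → Hosts211 (ZMod m) k →
    ∀ (G : Type) [AddCommGroup G] [Finite G], m ≤ Nat.card G → Hosts211 G k

end C10

/-- **C10 (c) ORDER-NOT-TYPE ABOVE THE ONSET** (STRUCTURE.md §2 C10, verbatim): «for every k and every n > onset_T2(k), EVERY abelian group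
of order n hosts (1,2,2)^k (N_k = onset_T2(k) + 1; AT the onset order the type may matter — k = 4, n = 32: ℤ₂×ℤ₁₆, ℤ₂³×ℤ₄, ℤ₂²×ℤ₈,
ℤ₂×ℤ₄², ℤ₄×ℤ₈ host, ℤ₃₂ and ℤ₂⁵ do not (engine ×1) — while at k = 5 even the onset order 48 is type-blind (p626247)). Suspected failure
mode to watch (named in advance, not a clause): small exponent (elementary abelian types) just above an onset.»  Typed as
`∀ k, C10.OrderNotTypeAt k`.  Scored tests: P-087.2 HIT (k = 4, KERNEL 9/9 + 24/24), P-088.1 VOID (post-dated), P-093.1 pending (k = 7,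
order 81: three of the four non-cyclic 3-groups host, `(ℤ/3)⁴` undecided — X-38), P-095.1 HIT (k = 9, n = 160), P-096.1 HIT #29 (k = 10),
P-105 HIT (k = 12 host law `exists_isSTPP_122pow12_of_card_ge_236`), P-109.1 law HIT #33 (k = 13, `exists_isSTPP_122pow13_of_card_ge_276`).
OPEN — a `def`, never
asserted without proof (CONVENTIONS §4). -/
def C10c : Prop := ∀ k : ℕ, C10.OrderNotTypeAt k

/-- **C10 (c″) CYCLIC-LAST** (STRUCTURE.md §2 C10, verbatim; registered 2026-08-28T22:03:13Z by lead g38, prereg P-092, X-33's next variant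
after (c′) was refuted as worded at (k, n) = (4, 17), `not_exists_isSTPP_211pow4_of_card_eq_17`): «for every k ≥ 2 and every n ≥ r_k :=
min { m : (2,1,1)^k ⊆ ℤ/m }, EVERY abelian group of order n hosts (2,1,1)^k (the cyclic group is the LAST abelian type of each order to
host; equivalently T1(G) ≥ T1(ℤ/|G|) plus the cyclic ray).»  Typed as `∀ k ≥ 2, C10.CyclicLastAt k`.  Evidence: KERNEL-TRUE at k = 2 … 6
(this file: `cyclicLastAt_two … six`); k = 7: above 38 KERNEL; k = 8: P-092.1 HIT KERNEL (6/6, p674488), host law `|G| ≥ 48` then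
`≥ 45` (`exists_isSTPP_211pow8_of_card_ge_45`), P-092.3 HIT (r₈ = 45); k = 9: P-095.2 HIT; k = 10: P-096.2 HIT #30.  OPEN — a `def`, never
asserted without proof (CONVENTIONS §4). -/
def C10c'' : Prop := ∀ k : ℕ, 2 ≤ k → C10.CyclicLastAt k

/-- **CONJECTURE C10 — THE T2 ONSET STRUCTURE** (STRUCTURE.md §2; status at typing: 22-surviving; nothing here bears on `ω`):
the conjunction of (a) LIFT-TIGHT, (b) T2 CYCLIC RAYS, (b′) T1 CYCLIC RAYS, (c) ORDER-NOT-TYPE ABOVE THE ONSET, (c″) CYCLIC-LAST.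
Typed; OPEN — a `def`, never
asserted without proof (CONVENTIONS §4). -/
def C10 : Prop := C10a ∧ C10b ∧ C10b' ∧ C10c ∧ C10c''

/-! ## Kernel rows: the instances the tree's closed forms already decide (`k ≤ 6`) -/

namespace C10

/-- Row `k = 2` of (a): onset_T1(2) = 6 (`ℤ/6` hosts) and no group of order `≤ 11` hosts `(1,2,2)²`. [cite: CohnKleinbergSzegedyUmans2005, Def. 5.1] -/
theorem liftTightAt_two : LiftTightAt 2 := by
  intro n hno G _ _ hG h
  have h6 : n < 6 := by
    by_contra hn
    exact hno (ZMod 6) (by rw [Nat.card_zmod]; omega) (stpp211pow2_iff_card.2 (by rw [Nat.card_zmod]))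
  have := stpp122pow2_iff_card.1 h
  omega

/-- Row `k = 3` of (a): onset_T1(3) = 12 (`ℤ/12` hosts) and no group of order `≤ 23` hosts `(1,2,2)³`. [cite: CohnKleinbergSzegedyUmans2005, Def. 5.1] -/
theorem liftTightAt_three : LiftTightAt 3 := by
  intro n hno G _ _ hG h
  have h12 : n < 12 := by
    by_contra hn
    exact hno (ZMod 12) (by rw [Nat.card_zmod]; omega) (stpp211pow3_iff_card.2 (by rw [Nat.card_zmod]))
  have := stpp122pow3_iff_card.1 h
  omega

/-- Row `k = 4` of (a): onset_T1(4) = 16 (`ℤ/2 × ℤ/8` hosts, `exists_isSTPP_211pow4_zmod2_zmod8`) and no finite abelian group of order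
`≤ 31` hosts `(1,2,2)⁴` (`not_exists_isSTPP_122pow4_of_card_le_31`): `32 = 2 · 16`. [cite: CohnKleinbergSzegedyUmans2005, Def. 5.1] -/
theorem liftTightAt_four : LiftTightAt 4 := by
  intro n hno G _ _ hG h
  have h16 : n < 16 := by
    by_contra hn
    refine hno (ZMod 2 × ZMod 8) ?_ exists_isSTPP_211pow4_zmod2_zmod8
    rw [Nat.card_prod, Nat.card_zmod, Nat.card_zmod]; omega
  exact not_exists_isSTPP_122pow4_of_card_le_31 (by omega) h

/-- Row `k = 2` of (b): the cyclic hosts of `(1,2,2)²` are `m ≥ 12`. [cite: CohnKleinbergSzegedyUmans2005, Def. 5.1] -/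
theorem cyclicRayT2At_two : CyclicRayT2At 2 := by
  intro m hm h
  haveI : NeZero m := ⟨by omega⟩
  have h12 := stpp122pow2_iff_card.1 h
  rw [Nat.card_zmod] at h12
  exact stpp122pow2_iff_card.2 (by rw [Nat.card_zmod]; omega)

/-- Row `k = 3` of (b): the cyclic hosts of `(1,2,2)³` are `m ≥ 24`. [cite: CohnKleinbergSzegedyUmans2005, Def. 5.1] -/
theorem cyclicRayT2At_three : CyclicRayT2At 3 := by
  intro m hm h
  haveI : NeZero m := ⟨by omega⟩
  have h24 := stpp122pow3_iff_card.1 h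
  rw [Nat.card_zmod] at h24
  exact stpp122pow3_iff_card.2 (by rw [Nat.card_zmod]; omega)

/-- Row `k = 4` of (b): a cyclic host `ℤ/m` of `(1,2,2)⁴` has `m ≥ 32`, so `ℤ/(m+1)` has order `≥ 33` and hosts (`stpp122pow4_iff`).
[cite: CohnKleinbergSzegedyUmans2005, Def. 5.1] -/
theorem cyclicRayT2At_four : CyclicRayT2At 4 := by
  intro m hm h
  haveI : NeZero m := ⟨by omega⟩
  have h32 : 32 ≤ m := by
    have := stpp122pow4_iff.1 h
    rw [Nat.card_zmod] at this
    omega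
  exact stpp122pow4_iff.2 (Or.inl (by rw [Nat.card_zmod]; omega))

/-- Row `k = 2` of (b′): the cyclic hosts of `(2,1,1)²` are `m ≥ 6`. [cite: CohnKleinbergSzegedyUmans2005, Def. 5.1] -/
theorem cyclicRayT1At_two : CyclicRayT1At 2 := by
  intro m hm h
  haveI : NeZero m := ⟨by omega⟩
  have h6 := stpp211pow2_iff_card.1 h
  rw [Nat.card_zmod] at h6
  exact stpp211pow2_iff_card.2 (by rw [Nat.card_zmod]; omega)

/-- Row `k = 3` of (b′): the cyclic hosts of `(2,1,1)³` are `m ≥ 12`. [cite: CohnKleinbergSzegedyUmans2005, Def. 5.1] -/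
theorem cyclicRayT1At_three : CyclicRayT1At 3 := by
  intro m hm h
  haveI : NeZero m := ⟨by omega⟩
  have h12 := stpp211pow3_iff_card.1 h
  rw [Nat.card_zmod] at h12
  exact stpp211pow3_iff_card.2 (by rw [Nat.card_zmod]; omega)

/-- Row `k = 4` of (b′): the cyclic hosts of `(2,1,1)⁴` are `m ≥ 18` (`exists_isSTPP_211pow4_zmod_iff`). [cite: CohnKleinbergSzegedyUmans2005, Def. 5.1] -/
theorem cyclicRayT1At_four : CyclicRayT1At 4 := by
  intro m hm h
  haveI : NeZero m := ⟨by omega⟩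
  have h18 := (exists_isSTPP_211pow4_zmod_iff m).1 h
  exact (exists_isSTPP_211pow4_zmod_iff (m + 1)).2 (by omega)

/-- Row `k = 5` of (b′): the cyclic hosts of `(2,1,1)⁵` are `m ≥ 24`. [cite: CohnKleinbergSzegedyUmans2005, Def. 5.1] -/
theorem cyclicRayT1At_five : CyclicRayT1At 5 := by
  intro m hm h
  haveI : NeZero m := ⟨by omega⟩
  have h24 := stpp211pow5_iff_card.1 h
  rw [Nat.card_zmod] at h24
  exact stpp211pow5_iff_card.2 (by rw [Nat.card_zmod]; omega)

/-- Row `k = 6` of (b′): the cyclic hosts of `(2,1,1)⁶` are `m ≥ 30` (`stpp211pow6_iff_card`). [cite: CohnKleinbergSzegedyUmans2005, Def. 5.1] -/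
theorem cyclicRayT1At_six : CyclicRayT1At 6 := by
  intro m hm h
  haveI : NeZero m := ⟨by omega⟩
  have h30 := stpp211pow6_iff_card.1 h
  rw [Nat.card_zmod] at h30
  exact stpp211pow6_iff_card.2 (by rw [Nat.card_zmod]; omega)

/-- Row `k = 2` of (c): `(1,2,2)² ⊆ G ⟺ |G| ≥ 12`, so every group larger than a host hosts. [cite: CohnKleinbergSzegedyUmans2005, Def. 5.1] -/
theorem orderNotTypeAt_two : OrderNotTypeAt 2 := by
  intro H _ _ hH G _ _ hlt
  have h12 := stpp122pow2_iff_card.1 hH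
  exact stpp122pow2_iff_card.2 (by omega)

/-- Row `k = 3` of (c): `(1,2,2)³ ⊆ G ⟺ |G| ≥ 24`. [cite: CohnKleinbergSzegedyUmans2005, Def. 5.1] -/
theorem orderNotTypeAt_three : OrderNotTypeAt 3 := by
  intro H _ _ hH G _ _ hlt
  have h24 := stpp122pow3_iff_card.1 hH
  exact stpp122pow3_iff_card.2 (by omega)

/-- Row `k = 4` of (c) (= P-087.2): a host has order `≥ 32`, so every larger group has order `≥ 33` and hosts (`stpp122pow4_iff`);
the onset order `32` itself is type-sensitive and outside the clause. [cite: CohnKleinbergSzegedyUmans2005, Def. 5.1] -/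
theorem orderNotTypeAt_four : OrderNotTypeAt 4 := by
  intro H _ _ hH G _ _ hlt
  have h32 : 32 ≤ Nat.card H := by
    have := stpp122pow4_iff.1 hH
    omega
  exact stpp122pow4_iff.2 (Or.inl (by omega))

/-- Row `k = 2` of (c″): `r₂ = 6` and every finite abelian group of order `≥ 6` hosts `(2,1,1)²`. [cite: CohnKleinbergSzegedyUmans2005, Def. 5.1] -/
theorem cyclicLastAt_two : CyclicLastAt 2 := by
  intro m hm h G _ _ hG
  haveI : NeZero m := ⟨by omega⟩
  have h6 := stpp211pow2_iff_card.1 h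
  rw [Nat.card_zmod] at h6
  exact stpp211pow2_iff_card.2 (by omega)

/-- Row `k = 3` of (c″): `r₃ = 12` and every finite abelian group of order `≥ 12` hosts `(2,1,1)³`. [cite: CohnKleinbergSzegedyUmans2005, Def. 5.1] -/
theorem cyclicLastAt_three : CyclicLastAt 3 := by
  intro m hm h G _ _ hG
  haveI : NeZero m := ⟨by omega⟩
  have h12 := stpp211pow3_iff_card.1 h
  rw [Nat.card_zmod] at h12
  exact stpp211pow3_iff_card.2 (by omega)

/-- Row `k = 4` of (c″): `r₄ = 18` (`ℤ/16`, `ℤ/17` carry none although the onset is `16`) and every finite abelian group of order `≥ 18`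
hosts `(2,1,1)⁴` (`stpp211pow4_iff`) — the cyclic group is the last type to host. [cite: CohnKleinbergSzegedyUmans2005, Def. 5.1] -/
theorem cyclicLastAt_four : CyclicLastAt 4 := by
  intro m hm h G _ _ hG
  haveI : NeZero m := ⟨by omega⟩
  have h18 := (exists_isSTPP_211pow4_zmod_iff m).1 h
  exact stpp211pow4_iff.2 (Or.inl (by omega))

/-- Row `k = 5` of (c″): `r₅ = 24` and every finite abelian group of order `≥ 24` hosts `(2,1,1)⁵`. [cite: CohnKleinbergSzegedyUmans2005, Def. 5.1] -/
theorem cyclicLastAt_five : CyclicLastAt 5 := by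
  intro m hm h G _ _ hG
  haveI : NeZero m := ⟨by omega⟩
  have h24 := stpp211pow5_iff_card.1 h
  rw [Nat.card_zmod] at h24
  exact stpp211pow5_iff_card.2 (by omega)

/-- Row `k = 6` of (c″): `r₆ = 30` and every finite abelian group of order `≥ 30` hosts `(2,1,1)⁶` (`stpp211pow6_iff_card`).
[cite: CohnKleinbergSzegedyUmans2005, Def. 5.1] -/
theorem cyclicLastAt_six : CyclicLastAt 6 := by
  intro m hm h G _ _ hG
  haveI : NeZero m := ⟨by omega⟩
  have h30 := stpp211pow6_iff_card.1 h
  rw [Nat.card_zmod] at h30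
  exact stpp211pow6_iff_card.2 (by omega)

end C10

end Summit.MatrixMultiplication.OmegaCensus
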